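import Summits.ValiantsHypothesis.ValiantsHypothesis.Theorems.SymPencilPerFourPeeledTwoPencilChordAQ
import Summits.ValiantsHypothesis.ValiantsHypothesis.Theorems.SymPencilPerFourPeeledTwoPencilChordW0Q

/-!
# Route `SymPencil` — inner rank of the `2 | 2` row split of `per_4`, PEELED case: three RESIDUAL
# CLASSES of the coverage programme, discharged by the charts S2 and W₀ (`--supports`
# stmt-ValiantsHypothesis-5674 `SdcSuperquadratic`; (8,8) column, memo
# `NOTE-p8g15-5674-R2-two-pencil.md` §9.6/§9.7; rung currency only)

Class lemmas in the currency of `…TwoPencilFrameless.false_of_peeled_of_frame_at` (the matrix-level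
frame body), for the explicit normal forms of memo §9.7 (other index patterns by
`…TwoPencilFramePerm.frame_of_perm`, p6 g16):

* `frames_of_generalized_swap` — `Ψ = μE₀₁ + λE₁₀`, ratio `r` with `rλ = −μ` off the exceptional
  set of the chord chart (class R1(ii); `λ = μ` is the pure swap, which has NO frame): `a₀ = 𝟙`,
  `a₁ = 𝟙 + e₂`, chart `…TwoPencilChordAQ.frames_of_chordA_of_indep`;
* `frames_of_swap_plus_offdiag` — `Ψ = λ(E₀₁+E₁₀) + cE₃₂` (class R2 core, first kind):
  `a₀ = (1,1,1,λ/c)`, `a₁ = a₀ + e₂`, chart `…TwoPencilChordW0Q.frames_of_W0_of_indep`;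
* `frames_of_swap_plus_diag` — `Ψ = λ(E₀₁+E₁₀) + cE₂₂` (class R2 core, second kind):
  `a₀ = (c, λ⁻¹, 1, 1)`, `a₁ = a₀ + e₃`, same chart.

Honest framing: class lemmas; no cell closes here; the window `28 ≤ sdc(per₄) ≤ 29` of record, the
crux `SdcSuperquadratic` and `VP ≠ VNP` are untouched.  No definitions, no named facts. [folklore]
-/

noncomputable section

-- single-conjunct layout: Sub = Summit, duplicated namespace component intended
set_option linter.dupNamespace false

namespace Summit.ValiantsHypothesis.ValiantsHypothesis.Theorems.SymPencilPerFourPeeledTwoPencilCoreClasses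

open Matrix Finset Module
open Summit.ValiantsHypothesis.ValiantsHypothesis.Theorems.SymPencilPerFourPeeledTwoPencilChordAQ
open Summit.ValiantsHypothesis.ValiantsHypothesis.Theorems.SymPencilPerFourPeeledTwoPencilChordW0Q

universe u

variable {K : Type u} [Field K]

/-- **Class R1(ii): the generalized swap `Ψ = μE₀₁ + λE₁₀`, `λ ≠ μ`** (ratio `r = −μ/λ` off the
exceptional set of the chord chart). [folklore] -/
theorem frames_of_generalized_swap [CharZero K] (Ψ : Matrix (Fin 4) (Fin 4) K) (la mu r : K)
    (hr_def : r * la = -mu)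
    (hr : r ≠ 0) (h1 : r + 1 ≠ 0) (h34 : 3 * r + 4 ≠ 0)
    (hcub : r ^ 3 - 8 * r ^ 2 - 20 * r - 12 ≠ 0) (hq1 : r ^ 2 + 4 * r + 1 ≠ 0)
    (hq2 : 4 * r ^ 2 + 7 * r + 4 ≠ 0) (hq3 : r ^ 2 + r + 1 ≠ 0)
    (hquart : r ^ 4 - 7 * r ^ 3 - 15 * r ^ 2 - 7 * r + 1 ≠ 0) (h3 : r - 3 ≠ 0)
    (hsq3 : r ^ 2 - 3 ≠ 0)
    (hΨ : Ψ = !![0, mu, 0, 0; la, 0, 0, 0; 0, 0, 0, 0; 0, 0, 0, 0]) :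
    ∃ (a₀ a₁ y₀ y₁ : Fin 4 → K) (P₀₀ P₁₀ P₀₁ P₁₁ W₀ : Matrix (Fin 4) (Fin 4) K)
        (v : Fin 4 → Fin 4 → K) (s : Fin 4 → K) (W : Matrix (Fin 4) (Fin 4) K),
        a₀ ⬝ᵥ Ψ *ᵥ y₀ = 0 ∧ a₀ ⬝ᵥ Ψ *ᵥ y₁ = 0 ∧ a₁ ⬝ᵥ Ψ *ᵥ y₀ = 0 ∧ a₁ ⬝ᵥ Ψ *ᵥ y₁ = 0 ∧
        (∀ b l, P₀₀ b l = (Matrix.of ![a₀, Pi.single b 1, y₀, Pi.single l 1]).permanent) ∧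
        (∀ b l, P₁₀ b l = (Matrix.of ![a₀, Pi.single b 1, y₁, Pi.single l 1]).permanent) ∧
        (∀ b l, P₀₁ b l = (Matrix.of ![a₁, Pi.single b 1, y₀, Pi.single l 1]).permanent) ∧
        (∀ b l, P₁₁ b l = (Matrix.of ![a₁, Pi.single b 1, y₁, Pi.single l 1]).permanent) ∧
        W₀ * P₀₀ = 1 ∧ (∀ j, P₁₀ *ᵥ v j = s j • P₀₀ *ᵥ v j) ∧ (∀ i j, i ≠ j → s i ≠ s j) ∧
        W * Matrix.of v = 1 ∧ P₁₁ - P₁₀ * W₀ * P₀₁ ≠ 0 := by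
  have hmu : mu = -(r * la) := by linear_combination hr_def
  refine frames_of_chordA_of_indep Ψ (fun _ => 1) ![1, 1, 2, 1] r (fun _ => one_ne_zero) ?_
    hr h1 h34 hcub hq1 hq2 hq3 hquart h3 hsq3 ?_ ?_ ?_ ?_
  · intro c e
    have e0 := congr_fun e 0
    have e2 := congr_fun e 2
    simp only [Pi.smul_apply, smul_eq_mul] at e0 e2
    have h0 : (![1, 1, 2, 1] : Fin 4 → K) 0 = 1 := rfl
    have h2 : (![1, 1, 2, 1] : Fin 4 → K) 2 = 2 := rfl
    rw [h0] at e0; rw [h2] at e2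
    have : (2 : K) = 1 := by linear_combination e2 - e0
    norm_num at this
  all_goals subst hΨ; subst hmu; simp [Matrix.mulVec, dotProduct, Fin.sum_univ_four]; ring

/-- **Class R2 core, first kind: `Ψ = λ(E₀₁+E₁₀) + cE₃₂`** (zero column `3`, swap pair `{0,1}`,
column `2 = c e₃`). [folklore] -/
theorem frames_of_swap_plus_offdiag [CharZero K] (Ψ : Matrix (Fin 4) (Fin 4) K) (la c : K)
    (hla : la ≠ 0) (hc : c ≠ 0)
    (hΨ : Ψ = !![0, la, 0, 0; la, 0, 0, 0; 0, 0, 0, 0; 0, 0, c, 0]) :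
    ∃ (a₀ a₁ y₀ y₁ : Fin 4 → K) (P₀₀ P₁₀ P₀₁ P₁₁ W₀ : Matrix (Fin 4) (Fin 4) K)
        (v : Fin 4 → Fin 4 → K) (s : Fin 4 → K) (W : Matrix (Fin 4) (Fin 4) K),
        a₀ ⬝ᵥ Ψ *ᵥ y₀ = 0 ∧ a₀ ⬝ᵥ Ψ *ᵥ y₁ = 0 ∧ a₁ ⬝ᵥ Ψ *ᵥ y₀ = 0 ∧ a₁ ⬝ᵥ Ψ *ᵥ y₁ = 0 ∧
        (∀ b l, P₀₀ b l = (Matrix.of ![a₀, Pi.single b 1, y₀, Pi.single l 1]).permanent) ∧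
        (∀ b l, P₁₀ b l = (Matrix.of ![a₀, Pi.single b 1, y₁, Pi.single l 1]).permanent) ∧
        (∀ b l, P₀₁ b l = (Matrix.of ![a₁, Pi.single b 1, y₀, Pi.single l 1]).permanent) ∧
        (∀ b l, P₁₁ b l = (Matrix.of ![a₁, Pi.single b 1, y₁, Pi.single l 1]).permanent) ∧
        W₀ * P₀₀ = 1 ∧ (∀ j, P₁₀ *ᵥ v j = s j • P₀₀ *ᵥ v j) ∧ (∀ i j, i ≠ j → s i ≠ s j) ∧
        W * Matrix.of v = 1 ∧ P₁₁ - P₁₀ * W₀ * P₀₁ ≠ 0 := by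
  refine frames_of_W0_of_indep Ψ ![1, 1, 1, la / c] ![1, 1, 2, la / c] ?_ ?_ ?_ ?_ ?_ ?_
  · intro k
    fin_cases k
    · simp
    · simp
    · simp
    · simpa using div_ne_zero hla hc
  · intro m e
    have e0 := congr_fun e 0
    have e2 := congr_fun e 2
    simp only [Pi.smul_apply, smul_eq_mul] at e0 e2
    have h0 : (![1, 1, 2, la / c] : Fin 4 → K) 0 = 1 := rfl
    have h0' : (![1, 1, 1, la / c] : Fin 4 → K) 0 = 1 := rfl
    have h2 : (![1, 1, 2, la / c] : Fin 4 → K) 2 = 2 := rfl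
    have h2' : (![1, 1, 1, la / c] : Fin 4 → K) 2 = 1 := rfl
    rw [h0, h0'] at e0; rw [h2, h2'] at e2
    have : (2 : K) = 1 := by linear_combination e2 - e0
    norm_num at this
  all_goals subst hΨ; simp [Matrix.mulVec, dotProduct, Fin.sum_univ_four]; field_simp; ring

/-- **Class R2 core, second kind: `Ψ = λ(E₀₁+E₁₀) + cE₂₂`** (zero column `3`, swap pair `{0,1}`,
column `2 = c e₂`). [folklore] -/
theorem frames_of_swap_plus_diag [CharZero K] (Ψ : Matrix (Fin 4) (Fin 4) K) (la c : K)
    (hla : la ≠ 0) (hc : c ≠ 0)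
    (hΨ : Ψ = !![0, la, 0, 0; la, 0, 0, 0; 0, 0, c, 0; 0, 0, 0, 0]) :
    ∃ (a₀ a₁ y₀ y₁ : Fin 4 → K) (P₀₀ P₁₀ P₀₁ P₁₁ W₀ : Matrix (Fin 4) (Fin 4) K)
        (v : Fin 4 → Fin 4 → K) (s : Fin 4 → K) (W : Matrix (Fin 4) (Fin 4) K),
        a₀ ⬝ᵥ Ψ *ᵥ y₀ = 0 ∧ a₀ ⬝ᵥ Ψ *ᵥ y₁ = 0 ∧ a₁ ⬝ᵥ Ψ *ᵥ y₀ = 0 ∧ a₁ ⬝ᵥ Ψ *ᵥ y₁ = 0 ∧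
        (∀ b l, P₀₀ b l = (Matrix.of ![a₀, Pi.single b 1, y₀, Pi.single l 1]).permanent) ∧
        (∀ b l, P₁₀ b l = (Matrix.of ![a₀, Pi.single b 1, y₁, Pi.single l 1]).permanent) ∧
        (∀ b l, P₀₁ b l = (Matrix.of ![a₁, Pi.single b 1, y₀, Pi.single l 1]).permanent) ∧
        (∀ b l, P₁₁ b l = (Matrix.of ![a₁, Pi.single b 1, y₁, Pi.single l 1]).permanent) ∧
        W₀ * P₀₀ = 1 ∧ (∀ j, P₁₀ *ᵥ v j = s j • P₀₀ *ᵥ v j) ∧ (∀ i j, i ≠ j → s i ≠ s j) ∧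
        W * Matrix.of v = 1 ∧ P₁₁ - P₁₀ * W₀ * P₀₁ ≠ 0 := by
  refine frames_of_W0_of_indep Ψ ![c, la⁻¹, 1, 1] ![c, la⁻¹, 1, 2] ?_ ?_ ?_ ?_ ?_ ?_
  · intro k
    fin_cases k
    · simpa using hc
    · simpa using hla
    · simp
    · simp
  · intro m e
    have e2 := congr_fun e 2
    have e3 := congr_fun e 3
    simp only [Pi.smul_apply, smul_eq_mul] at e2 e3
    have h2 : (![c, la⁻¹, 1, 2] : Fin 4 → K) 2 = 1 := rfl
    have h2' : (![c, la⁻¹, 1, 1] : Fin 4 → K) 2 = 1 := rfl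
    have h3 : (![c, la⁻¹, 1, 2] : Fin 4 → K) 3 = 2 := rfl
    have h3' : (![c, la⁻¹, 1, 1] : Fin 4 → K) 3 = 1 := rfl
    rw [h2, h2'] at e2; rw [h3, h3'] at e3
    have : (2 : K) = 1 := by linear_combination e3 - e2
    norm_num at this
  all_goals subst hΨ; simp [Matrix.mulVec, dotProduct, Fin.sum_univ_four]; field_simp; ring

end Summit.ValiantsHypothesis.ValiantsHypothesis.Theorems.SymPencilPerFourPeeledTwoPencilCoreClasses

end
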